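import Summits.HodgeConjecture.HodgeConjecture.Theses.MirrorBraneLift

/-!
# Birth skeleton (BC3) — crux `TropicalWeilSupply` of route `MirrorBraneLift`

Crux item `stmt-HodgeConjecture-18676`, decl
`Summit.HodgeConjecture.HodgeConjecture.Theses.MirrorBraneLift.TropicalWeilSupply` (FIXED; never restated
here): for every `n ≥ 2`, `δ ≥ 1` and every VERY GENERAL member `P` of the tropical Weil family `𝓛_δ⁺`
(`WeilFamily.Polarization n δ`, `P.IsVeryGeneral`) there is an effective tropical `n`-cycle
`Z : TropicalTorusCycle (2n) n P.Q` on `B_Q = ℝ²ⁿ/Qℤ²ⁿ` with non-zero `ℚ(√-δ)`-Weil functional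
`WeilFamily.functional δ Z ≠ 0`.

## The seam — "one very general instance per `(n, δ)` suffices" (isogeny orbit + generic spread)

Write `Supp(n, δ) ⊆ 𝓛_δ⁺` for the set of members carrying an effective tropical `n`-cycle with non-zero
Weil functional. Three structural facts about `Supp`, each a genuine lemma and each provable by
finite-dimensional linear algebra over the certificate format of `TropicalTorusCycle`, reduce the crux
(a statement about EVERY very general member) to the existence of ONE very general member of `Supp`:

* `stub_openNearVeryGeneral` — GENERIC SPREAD (size L; true): if a very general `P₀` lies in `Supp`
  then a whole open neighbourhood of `P₀.Q` does (`∃ U` open, `P₀.Q ∈ U`, every member `P` with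
  `P.Q ∈ U` in `Supp`). Mechanism: freeze the discrete data of the witness cycle `Z₀` (weights, frames,
  facet classes / permutations / lattice shifts); its realisations over a period matrix `Q` are the
  solutions `u = (vertices, refFacets, edgeCoeffs)` of a LINEAR system `M u = S·vec Q` with INTEGER
  `M, S` (`facet_eq`, `vertex_succ_sub`) inside the open set `{det T_σ > 0}`; solvability is a finite
  set of `ℤ`-linear conditions on the `n²` free coordinates `P.coord` (the entries of `Q = (δQ₀, Q₂;
  -Q₂, Q₀)` are `ℤ`-linear in them, `δ ≥ 1`), satisfied at the algebraically independent `P₀.coord`,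
  hence IDENTICALLY on the family; `u(Q) := u₀ + M⁺ S (vec Q - vec Q₀)` is a continuous family of
  realisations through `Z₀`, and `det T_σ > 0`, `functional ≠ 0` are open conditions. (Same lever as
  the sibling negative skeleton `Cruxes/TropicalWeilVanishing/Lines/birth.lean`, `stub_genericSpread`,
  there for `n = 4`, `δ = 1` and "non-theta class"; one proof serves both.)
  [Zharkov2020TropicalWeil pp. 2–4 ("vertices vary rationally over the space of parameters");
  MikhalkinZharkov2014Eigenwave Def. 4.2]
* `stub_denseIsogenyOrbit` — DENSE ISOGENY ORBITS (size M/L; true): for every member `P` and every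
  open `U` meeting `𝓛_δ⁺` there are an integer matrix `h` commuting with `J = WeilFamily.J n δ`
  (`det h ≠ 0`, i.e. `h ∈ M_n(ℤ[√-δ]) ∩ GL_n(K)`) and `t > 0` with `t·(h P.Q hᵀ) ∈ U`, again a member
  `P'` of the family. Mechanism: the commutant of `J` in `M_{2n}(ℝ)` is a rational subspace
  (`J` integral), so its rational points `= (1/N)·(integral h)` are dense in it; it is `≅ M_n(ℂ)`
  (`(Jᵀ/√δ)² = -1`), and its invertible elements act TRANSITIVELY on `𝓛_δ⁺` by `Q ↦ g Q gᵀ`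
  (two `Jᵀ`-hermitian inner products on `ℝ²ⁿ` differ by a `ℂ`-linear map: unitary Gram–Schmidt);
  a dense subgroup of a transitively acting group has dense orbits, and
  `g Q gᵀ = (1/N²)·h Q hᵀ`. Skew-ness `(J·hQhᵀ)ᵀ = -(J·hQhᵀ)` and positivity of `t·hQhᵀ` are part
  of the stub (`Matrix.PosDef.conjTranspose_mul_mul_same`). [vanGeemen1994HodgeAV §5.2–5.3 (the
  Weil family as `K`-hermitian forms); MikhalkinZharkov2014Eigenwave Def. 6.1]
* `stub_isogenyTransport` — ISOGENY / HOMOTHETY INVARIANCE OF SUPPLY (size L; true): with `h, t` as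
  above and `P'.Q = t·(h P.Q hᵀ)`, supply at `P'` gives supply at `P`. Mechanism: `x ↦ hx` is
  `ℂ`-linear for `z_k = x_k + i√δ·x_{k+n}` (`hJ = Jh`), so `frameDet (hL) = det_ℂ(h)·frameDet L`;
  the homothety `x ↦ t·x` identifies `B_Q` with `B_{tQ}` (slopes and frames unchanged, `a_σ ↦ tⁿa_σ`,
  functional `↦ tⁿ·functional`); `x ↦ hx` induces `B_Q ≅ ℝ²ⁿ/hQℤ²ⁿ`, which is covered with degree
  `|det h|` by `B_{hQhᵀ}` (`hᵀℤ²ⁿ ⊆ ℤ²ⁿ`): push the witness cycle of `B_{hQhᵀ}` forward along the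
  covering, pull it back along `x ↦ hx` (rational change of slope lattice: re-saturate every frame,
  absorb the indices into the weights, clear denominators by one common integer factor — balancing
  is preserved identically, effectivity and `det T_σ > 0` by orienting the new frames); the Weil
  functional is multiplied by a non-zero constant (`det_ℂ(h)⁻² ≠ 0` times positive rationals).
  [MikhalkinZharkov2014Eigenwave Def. 4.2, Prop. 4.3, Def. 6.1; Zharkov2020TropicalWeil §2]
* `stub_pointSupply` — THE BET, in its weakest form (size XL; the research content of the crux): for
  every `n ≥ 2`, `δ ≥ 1` there is ONE very general member `P₀ ∈ 𝓛_δ⁺` carrying ONE effective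
  tropical `n`-cycle with non-zero Weil functional. Known regime: `n = 2` (the archive's Theorem A:
  on the very general tropical Weil 4-torus the classes of effective tropical 2-cycles span
  `ℚθ₂ ⊕ W^trop`, via tropicalisation of the algebraic Weil cycles of van Geemen / Schoen / Koike /
  Markman on the split Weil fourfolds `A_H ⊗ ℂ` — all `K` for `m = 2`; `functional` kills `θ₂` and
  not `W^trop`); `n = 3`, `δ ∈ {1, 3}` conditionally on the same tropicalisation theorem; open for
  `n ≥ 4` (no effective tropical Weil `4`-cycle known; Kontsevich's programme and the sibling route
  `TropicalWeilObstruction` bet on NON-existence at `n = 4`, `δ = 1`). A formal effective cycle over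
  any open cone of `𝓛_δ⁺` (vertices affine in the parameters, Kontsevich's `Γ₂ ⊗ Γ_p` setup) with
  Weil functional `≢ 0` proves it for that `(n, δ)` (open cones contain very general points).
  [Zharkov2020TropicalWeil §2; MikhalkinZharkov2014Eigenwave Thm 5.4; vanGeemen1994HodgeAV Thm 6.12;
  Schoen1998HodgeWeilAddendum; Markman2025SecantWeil]

`TropicalWeilSupply_of` is the real (sorry-free) composition: given `n ≥ 2`, `δ ≥ 1` and a member
`P` (its very-generality is not even needed — the engine proves supply at EVERY member, which by
`stub_openNearVeryGeneral` is EQUIVALENT to the crux, not stronger: crux ⇒ one very general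
instance ⇒ open set of supply ⇒ dense-orbit transport ⇒ all members): `stub_pointSupply` gives a
very general `P₀ ∈ Supp`; generic spread gives an open `U ∋ P₀.Q` inside `Supp`; the dense isogeny
orbit of `P` meets `U` in some `P' = t·hPhᵀ`; isogeny transport carries supply from `P'` back to `P`.
Consequently a REFUTATION of the crux also needs only one member (any member, special or not) of
some `𝓛_δ⁺`, `n ≥ 2`, with NO effective cycle of non-zero Weil functional.

No stub alone gives the crux (stub 1 is one instance; stubs 2–4 produce no cycle from nothing) nor
`HodgeConjecture`; BC3 probes (`stub → TropicalWeilSupply`, `stub → HodgeConjecture` by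
`first | exact? | simpa [·] | (unfold ·; simpa) | aesop`) are run in the sibling probe file
`bc/TropicalWeilSupply_probes.lean` (statements re-declared verbatim, skeleton NOT imported so that
`exact?` cannot see the sorried stubs) and all fail (registering seat's NOTES.md).
Disproof used: none (no `Disproof.lean` / Negative lemma on this crux at registration). Dead lines: none
recorded on the item; the route's recorded tropical death (TropicalCuspLift, stmt-2620, K-balance at
depth-one cusps) concerns a different object.
-/

namespace Summit.HodgeConjecture.HodgeConjecture.Cruxes.TropicalWeilSupply.Birth

open scoped Matrix
open Summit.HodgeConjecture.HodgeConjecture.Theses.MirrorBraneLift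

/-- **Stub 1 statement — point supply (the bet, weakest form).** For every `n ≥ 2` and `δ ≥ 1` some
VERY GENERAL member `P₀` of the tropical Weil family `𝓛_δ⁺` carries an effective tropical `n`-cycle
with non-zero `ℚ(√-δ)`-Weil functional. [cite: Zharkov2020TropicalWeil, §2 (pp. 2–4)]
[cite: MikhalkinZharkov2014Eigenwave, Thm. 5.4] -/
def PointSupply : Prop :=
  ∀ (n : ℕ), 2 ≤ n → ∀ (δ : ℕ), 1 ≤ δ →
    ∃ P₀ : Literature.AlgebraicGeometry.Tropical.WeilFamily.Polarization n δ, P₀.IsVeryGeneral ∧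
      ∃ Z₀ : Literature.AlgebraicGeometry.Tropical.TropicalTorusCycle (2 * n) n P₀.Q,
        Literature.AlgebraicGeometry.Tropical.WeilFamily.functional δ Z₀ ≠ 0

/-- **Stub 2 statement — generic spread (openness of supply at a very general member).** If a very
general `P₀ ∈ 𝓛_δ⁺` (`δ ≥ 1`) carries an effective tropical `n`-cycle with non-zero Weil functional,
then so does every member `P` whose period matrix lies in some open neighbourhood `U` of `P₀.Q`
(the witness's combinatorial type realises continuously over all of the family near `P₀`: the integer
linear realisation system is solvable identically because its solvability conditions are `ℤ`-linear in
the algebraically independent coordinates of `P₀`). [cite: Zharkov2020TropicalWeil, §2 (pp. 2–4)]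
[cite: MikhalkinZharkov2014Eigenwave, Def. 4.2] -/
def OpenNearVeryGeneral : Prop :=
  ∀ (n δ : ℕ), 1 ≤ δ → ∀ P₀ : Literature.AlgebraicGeometry.Tropical.WeilFamily.Polarization n δ,
    P₀.IsVeryGeneral →
    (∃ Z₀ : Literature.AlgebraicGeometry.Tropical.TropicalTorusCycle (2 * n) n P₀.Q,
        Literature.AlgebraicGeometry.Tropical.WeilFamily.functional δ Z₀ ≠ 0) →
    ∃ U : Set (Matrix (Fin (2 * n)) (Fin (2 * n)) ℝ), IsOpen U ∧ P₀.Q ∈ U ∧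
      ∀ P : Literature.AlgebraicGeometry.Tropical.WeilFamily.Polarization n δ, P.Q ∈ U →
        ∃ Z : Literature.AlgebraicGeometry.Tropical.TropicalTorusCycle (2 * n) n P.Q,
          Literature.AlgebraicGeometry.Tropical.WeilFamily.functional δ Z ≠ 0

/-- **Stub 3 statement — dense isogeny orbits.** For every member `P ∈ 𝓛_δ⁺` (`δ ≥ 1`) and every open
set `U` of real `2n × 2n` matrices meeting `𝓛_δ⁺`, there are an integer matrix `h` with `det h ≠ 0`
commuting with `J = WeilFamily.J n δ` and a real `t > 0` such that `t·(h P.Q hᵀ)` lies in `U` and is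
again (the period matrix of) a member `P'` (rational points of the commutant of `J` are dense in it,
and its invertible elements act transitively on `𝓛_δ⁺` by congruence).
[cite: vanGeemen1994HodgeAV, §5.2–5.3] [cite: MikhalkinZharkov2014Eigenwave, Def. 6.1] -/
def DenseIsogenyOrbit : Prop :=
  ∀ (n δ : ℕ), 1 ≤ δ → ∀ (P : Literature.AlgebraicGeometry.Tropical.WeilFamily.Polarization n δ)
    (U : Set (Matrix (Fin (2 * n)) (Fin (2 * n)) ℝ)), IsOpen U →
    (∃ P₁ : Literature.AlgebraicGeometry.Tropical.WeilFamily.Polarization n δ, P₁.Q ∈ U) →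
    ∃ (P' : Literature.AlgebraicGeometry.Tropical.WeilFamily.Polarization n δ)
      (h : Matrix (Fin (2 * n)) (Fin (2 * n)) ℤ) (t : ℝ),
      0 < t ∧ h.det ≠ 0 ∧
      h.map ((↑) : ℤ → ℝ) * Literature.AlgebraicGeometry.Tropical.WeilFamily.J n δ =
        Literature.AlgebraicGeometry.Tropical.WeilFamily.J n δ * h.map ((↑) : ℤ → ℝ) ∧
      P'.Q = t • (h.map ((↑) : ℤ → ℝ) * P.Q * (h.map ((↑) : ℤ → ℝ))ᵀ) ∧ P'.Q ∈ U

/-- **Stub 4 statement — isogeny / homothety transport of supply.** If `P'.Q = t·(h P.Q hᵀ)` with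
`t > 0` and `h` an integer matrix of non-zero determinant commuting with `J`, then an effective tropical
`n`-cycle with non-zero Weil functional on `B_{P'.Q}` yields one on `B_{P.Q}` (homothety `x ↦ t x`;
push-forward along the degree-`|det h|` covering `B_{hQhᵀ} → ℝ²ⁿ/hQℤ²ⁿ ≅ B_Q`, pull-back along the
`ℂ`-linear `x ↦ hx` with re-saturated frames; the functional changes by a non-zero constant).
[cite: MikhalkinZharkov2014Eigenwave, Def. 4.2 and Prop. 4.3] [cite: Zharkov2020TropicalWeil, §2 (pp. 2–4)] -/
def IsogenyTransport : Prop :=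
  ∀ (n δ : ℕ), 1 ≤ δ → ∀ (P P' : Literature.AlgebraicGeometry.Tropical.WeilFamily.Polarization n δ)
    (h : Matrix (Fin (2 * n)) (Fin (2 * n)) ℤ) (t : ℝ), 0 < t → h.det ≠ 0 →
    h.map ((↑) : ℤ → ℝ) * Literature.AlgebraicGeometry.Tropical.WeilFamily.J n δ =
      Literature.AlgebraicGeometry.Tropical.WeilFamily.J n δ * h.map ((↑) : ℤ → ℝ) →
    P'.Q = t • (h.map ((↑) : ℤ → ℝ) * P.Q * (h.map ((↑) : ℤ → ℝ))ᵀ) →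
    (∃ Z' : Literature.AlgebraicGeometry.Tropical.TropicalTorusCycle (2 * n) n P'.Q,
        Literature.AlgebraicGeometry.Tropical.WeilFamily.functional δ Z' ≠ 0) →
    ∃ Z : Literature.AlgebraicGeometry.Tropical.TropicalTorusCycle (2 * n) n P.Q,
      Literature.AlgebraicGeometry.Tropical.WeilFamily.functional δ Z ≠ 0

/-- Stub 1 — point supply: THE BET (XL). [cite: Zharkov2020TropicalWeil, §2 (pp. 2–4)] -/
theorem stub_pointSupply : PointSupply := by
  sorry

/-- Stub 2 — generic spread at a very general member (L; integer linear realisation system +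
algebraic independence). [cite: Zharkov2020TropicalWeil, §2 (pp. 2–4)] -/
theorem stub_openNearVeryGeneral : OpenNearVeryGeneral := by
  sorry

/-- Stub 3 — dense isogeny orbits (M/L; rational points of the commutant of `J` are dense, the
commutant acts transitively on `𝓛_δ⁺`). [cite: vanGeemen1994HodgeAV, §5.2–5.3] -/
theorem stub_denseIsogenyOrbit : DenseIsogenyOrbit := by
  sorry

/-- Stub 4 — isogeny / homothety transport of supply (L; push–pull of certificate cycles, re-saturation,
`frameDet (hL) = det_ℂ h · frameDet L`). [cite: MikhalkinZharkov2014Eigenwave, Def. 4.2 and Prop. 4.3] -/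
theorem stub_isogenyTransport : IsogenyTransport := by
  sorry

/-! ## Name-keyed aliases of the four statements — the hypotheses of `TropicalWeilSupply_of`
The native skeleton audit (`#h21_check_skeleton`) admits a hypothesis of the skeleton theorem only if its head
constant is a registered obligation or is NAMED like a declared stub; `__Registered.stub_X` is the statement of
`stub_X` under the registered stub's short name (device of `Cruxes/AlgebraicDensity/Lines/birth.lean` and
`Cruxes/TropicalWeilVanishing/Lines/birth.lean`; the `__` namespace is an implementation detail, so the audit's
stub report resolves each `stub_…` to the sorried theorem above, not to its alias). -/
namespace __Registered

/-- Alias of `PointSupply` keyed by the registered stub name. -/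
abbrev stub_pointSupply : Prop := PointSupply
/-- Alias of `OpenNearVeryGeneral` keyed by the registered stub name. -/
abbrev stub_openNearVeryGeneral : Prop := OpenNearVeryGeneral
/-- Alias of `DenseIsogenyOrbit` keyed by the registered stub name. -/
abbrev stub_denseIsogenyOrbit : Prop := DenseIsogenyOrbit
/-- Alias of `IsogenyTransport` keyed by the registered stub name. -/
abbrev stub_isogenyTransport : Prop := IsogenyTransport

end __Registered

/-- **Composition (real proof) — THE SKELETON THEOREM.** One very general instance of supply
(stub 1) spreads to an open set `U` (stub 2); the isogeny orbit of an arbitrary member `P` is dense,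
so some `P' = t·hPhᵀ` lies in `U` (stub 3) and carries supply, which transports back to `P` along the
isogeny (stub 4). Hypotheses = the four stub statements (name-keyed aliases); concludes the route decl
`TropicalWeilSupply` BY NAME (the very-generality binder of the crux is not consumed: the engine
proves supply at every member, a statement equivalent to the crux by stub 2). -/
theorem TropicalWeilSupply_of :
    __Registered.stub_pointSupply → __Registered.stub_openNearVeryGeneral →
      __Registered.stub_denseIsogenyOrbit → __Registered.stub_isogenyTransport → TropicalWeilSupply := by
  intro h₁ h₂ h₃ h₄ n hn δ hδ P _hP
  obtain ⟨P₀, hP₀, hZ₀⟩ := h₁ n hn δ hδ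
  obtain ⟨U, hUo, hP₀U, hU⟩ := h₂ n δ hδ P₀ hP₀ hZ₀
  obtain ⟨P', h, t, ht, hdet, hJ, hQ, hP'U⟩ := h₃ n δ hδ P U hUo ⟨P₀, hP₀U⟩
  exact h₄ n δ hδ P P' h t ht hdet hJ hQ (hU P' hP'U)

/-- **The crux, closed modulo exactly the four registered stubs** (sanity: the stubs compose, and
each alias is its stub's statement). -/
theorem TropicalWeilSupply_of_stubs : TropicalWeilSupply :=
  TropicalWeilSupply_of stub_pointSupply stub_openNearVeryGeneral stub_denseIsogenyOrbit
    stub_isogenyTransport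

end Summit.HodgeConjecture.HodgeConjecture.Cruxes.TropicalWeilSupply.Birth
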